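import Literature.MathematicalPhysics.QuantumFieldTheory.Balaban1983to89.B8Eq191FlatStencilsRec
import Literature.MathematicalPhysics.QuantumFieldTheory.Balaban1983to89.B8Eq191FlatTowerGramRec
import Literature.MathematicalPhysics.QuantumFieldTheory.Balaban1983to89.B8Eq191FlatGreenDirichlet

/-!
# `Balaban1983to89.B8Eq191FlatGreenDirichletRec` — [Balaban1985RegularSpaces] (1.91) p. 91 ∕ (1.95) p. 92, [Balaban1985BackgroundPropagators] Thm 3.1 p. 397 AT `U₀ = 1`, FOR THE
# RECORD's AVERAGING STRUCTURE ([Balaban1987RG1] (0.3): centred blocks): the flat Dirichlet Green's function `G′(1) = (Δ_{Ω₀} + Q′ᵀaQ′)⁻¹` on a finite region with its letters and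
# laws — the record twin of `B8Eq191FlatGreenDirichlet` (R6, δ sub-chain; LEAD PEN dag-n05-e)

statement-level skeleton of published theorems with citation tags; proofs where landed; nothing here is a claim about the Yang–Mills mass gap

CITATION HEADER (lean-in-tree rule).  Cell `pub-ymgap` (HUMAN RULING D-0062), «N05-REC» road (director-ym №254∕№255; LEAD PEN dag-n05-e g37; `N05-REC-INVENTORY.md` §R6 row `B8Eq191FlatGreenDirichlet —
A: QT_flat_add, QT_flat_smul`; desk `R6-PLAN.md` §2 (d)).  [6] = [Balaban1985RegularSpaces] (1.91) p. 91, (1.95) p. 92, Prop. 6 p. 99; [4] = [Balaban1985BackgroundPropagators] Thm 3.1 p. 397,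
(3.19) p. 393, (3.23)–(3.25) p. 394; [B6] = [Balaban1984PropagatorsII] p. 235; [I] = [Balaban1987RG1] (0.3) p. 252.  `--kind proof --supports stmt-QuantumFields-20541` (K0⁷; count-neutral;
no definition).  TOKEN MAP: `QT ↦ QTZ`, `QprimeIter (zdBlocking d L) (bgT L 1) ↦ QprimeIter (zdBlockingZ d L) (bgTZ L 1)`, `blockMap (Lʲ) ↦ flmZ L j`, `1 ≤ L ↦ Odd L` (the centred labels);
`flatDirichletOp_eq_sum_of_supp ↦ B8Eq191FlatStencilsRec.flatDirichletOpZ_eq_sum_of_supp`, `isUnit_flatMatrix ↦ B8Eq191FlatTowerGramRec.isUnit_flatMatrixZ`, `QT_flat_apply ↦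
B8Eq138LandauFlatOrthogonalRec.QTZ_flat_apply` (dag-n05-d); class-0 `covLap_flat_add ∕ covLap_flat_smul` reused BY NAME from the engine file.  Proof text otherwise byte-identical to the engine's.

WHAT IS PROVED (sorry-free).  §1 `QTZ_flat_add`, `QTZ_flat_smul` (linearity of the flat record `Q′ᵀ` in the multiplier); §2 ★★ `exists_flatGreenZ_dirichlet` — for `d ≥ 1`, `η ≠ 0`, odd `L`, level
weights `a_j ≥ 0`, a structure `{Λ_j}` read up to level `m` and a FINITE `Ω₀ ⊂ ℤᵈ`: `ℂ`-linear letters `g = G′(1)`, `Δ`, `q = Q′(1)`, `qs = Q′(1)ᵀ`, `Aw = a` with the RIGHT-INVERSE LAW POINTWISE ON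
`Ω₀`, the readings `Δ f = Δ^η_1(𝟙_{Ω₀}f)`, `qs = Q′(1)ᵀ` (record: `QTZ`), `q f = Q′_j(1)f` on `Λ_j` (record: `QprimeIter (zdBlockingZ d L) (bgTZ L 1)`), `Aw μ = (a_jμ_j)_j`; the Dirichlet range;
reality; UNIQUENESS of `Ω₀`-supported solutions.
HONEST SCOPE.  Finite linear algebra at the flat background; existence and algebra only, no estimate; nothing of [4]∕[6]∕[B6]∕[I] asserted beyond it; `HThm4Rec` UNDISCHARGED; N05 ∕ N07 NOT
discharged; counts unmoved (typed 28∕28 · discharged 8∕28); one finite 𝕋⁴ programme at fixed ε — nothing continuum ∕ ℝ⁴ ∕ OS ∕ mass gap ∕ Clay.  No `def`, no `instance`, no `notation`,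
no `sorry`.
-/

noncomputable section

namespace Literature.MathematicalPhysics.QuantumFieldTheory.Balaban1983to89.B8Eq191FlatGreenDirichletRec

open Finset
open scoped Matrix
open B7Prop1Explicit (e)
open B7Eq78Linearization (QprimeIter QprimeIter_add QprimeIter_smul)
open B7SectEFLinearisationRec (zdBlockingZ bgTZ)
open B8Eq119TwistedAxialRec (flmZ)
open B8Eq138LandauZd (covLap)
open B8Eq138LandauZdRec (QTZ)
open B8Eq138LandauFlatOrthogonalRec (QTZ_flat_apply)
open B8Eq191FlatStencilsRec (flatDirichletOpZ_eq_sum_of_supp QprimeIter_bgTZ_one)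
open B8Eq191FlatTowerGramRec (isUnit_flatMatrixZ)
open B8Eq191FlatGreenDirichlet (covLap_flat_add covLap_flat_smul)

variable {d : ℕ}

/-! ## §1 Linearity of the flat record `Q′ᵀ` -/

section Linear

variable {𝔸 : Type*} [NormedRing 𝔸] [NormedAlgebra ℂ 𝔸]

variable [CompleteSpace 𝔸]

/-- (RECORD TWIN of `QT_flat_add`.) The flat record `Q′ᵀ` is additive in the multiplier (odd `L`). [cite: Balaban1985BackgroundPropagators, (3.24) p.394] -/
theorem QTZ_flat_add {L : ℕ} (hLo : Odd L) (m : ℕ) (Λs : ℕ → Set (Fin d → ℤ)) (μ ν : ℕ → (Fin d → ℤ) → 𝔸) (x : Fin d → ℤ) :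
    QTZ L m Λs (1 : (Fin d → ℤ) → Fin d → 𝔸ˣ) (μ + ν) x =
      QTZ L m Λs (1 : (Fin d → ℤ) → Fin d → 𝔸ˣ) μ x + QTZ L m Λs (1 : (Fin d → ℤ) → Fin d → 𝔸ˣ) ν x := by
  rw [QTZ_flat_apply hLo, QTZ_flat_apply hLo, QTZ_flat_apply hLo, ← Finset.sum_add_distrib]
  refine Finset.sum_congr rfl fun j _ => ?_
  rw [← smul_add]
  congr 1
  by_cases h : flmZ L j x ∈ Λs j
  · simp only [Set.indicator_of_mem h, Pi.add_apply]
  · simp only [Set.indicator_of_notMem h, add_zero]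

/-- (RECORD TWIN of `QT_flat_smul`.) The flat record `Q′ᵀ` is `ℂ`-homogeneous in the multiplier (odd `L`). [cite: Balaban1985BackgroundPropagators, (3.24) p.394] -/
theorem QTZ_flat_smul {L : ℕ} (hLo : Odd L) (m : ℕ) (Λs : ℕ → Set (Fin d → ℤ)) (c : ℂ) (μ : ℕ → (Fin d → ℤ) → 𝔸) (x : Fin d → ℤ) :
    QTZ L m Λs (1 : (Fin d → ℤ) → Fin d → 𝔸ˣ) (c • μ) x = c • QTZ L m Λs (1 : (Fin d → ℤ) → Fin d → 𝔸ˣ) μ x := by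
  rw [QTZ_flat_apply hLo, QTZ_flat_apply hLo, Finset.smul_sum]
  refine Finset.sum_congr rfl fun j _ => ?_
  rw [smul_comm c]
  congr 1
  by_cases h : flmZ L j x ∈ Λs j
  · simp only [Set.indicator_of_mem h, Pi.smul_apply]
  · simp only [Set.indicator_of_notMem h, smul_zero]

end Linear

/-! ## §2 The flat Dirichlet Green's function of the record blocking and its laws -/

section Green

variable {𝔸 : Type*} [CStarAlgebra 𝔸]

open Classical in
/-- ★★ (RECORD TWIN of `exists_flatGreen_dirichlet`: centred blocking `zdBlockingZ ∕ bgTZ ∕ QTZ ∕ flmZ`, odd `L`.) **THE FLAT DIRICHLET GREEN'S FUNCTION `G′(1) = (Δ_{Ω₀} + Q′ᵀaQ′)⁻¹` ON A FINITE REGION FOR THE RECORD's AVERAGING, WITH ITS LETTERS AND LAWS** ([4] Thm 3.1 at `U = 1`, existence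
and algebra only): for `d ≥ 1`, `η ≠ 0`, `L ≥ 1`, level weights `a_j ≥ 0`, a structure `{Λ_j}` read up to level `m` and a FINITE `Ω₀ ⊂ ℤᵈ` there are
`ℂ`-linear letters `g = G′(1)`, `Δ`, `q = Q′(1)`, `qs = Q′(1)ᵀ`, `Aw = a` such that: the RIGHT-INVERSE LAW POINTWISE ON `Ω₀`
(`(Δ(G′x) + Q′ᵀaQ′(G′x))(y) = x(y)`, `y ∈ Ω₀`); the readings `Δ f = Δ^η_1(𝟙_{Ω₀}f)` on `Ω₀` (Dirichlet), `qs = Q′(1)ᵀ` on `Ω₀`, `q f = Q′_j(1)f` on `Λ_j`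
(`j ≤ m`), `Aw μ = (a_jμ_j)_j`; the Dirichlet range `G′f = 0` off `Ω₀`; reality (`f` self-adjoint on `Ω₀` ⇒ `G′f` self-adjoint); and UNIQUENESS of
`Ω₀`-supported solutions.  `G′(1)` is `K⁻¹ ⊗ id_𝔸` for the unit real matrix `K` of `B8Eq191FlatTowerGramRec.isUnit_flatMatrixZ`.
[cite: Balaban1985RegularSpaces, (1.91) p.91, (1.95) p.92, Prop. 6 p.99; Balaban1985BackgroundPropagators, Thm 3.1 p.397, (3.23)–(3.25) p.394; Balaban1984PropagatorsII, p.235; Balaban1987RG1, (0.3) p.252] -/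
theorem exists_flatGreenZ_dirichlet (hd : 0 < d) {η : ℝ} (hη : η ≠ 0) {L : ℕ} (hLo : Odd L) (m : ℕ) (Λs : ℕ → Set (Fin d → ℤ))
    (a : ℕ → ℝ) (ha : ∀ j, 0 ≤ a j) (Ω₀ : Set (Fin d → ℤ)) (hΩ : Ω₀.Finite) :
    ∃ (g Δ : ((Fin d → ℤ) → 𝔸) →ₗ[ℂ] ((Fin d → ℤ) → 𝔸)) (q : ((Fin d → ℤ) → 𝔸) →ₗ[ℂ] (ℕ → (Fin d → ℤ) → 𝔸))
      (qs : (ℕ → (Fin d → ℤ) → 𝔸) →ₗ[ℂ] ((Fin d → ℤ) → 𝔸)) (Aw : (ℕ → (Fin d → ℤ) → 𝔸) →ₗ[ℂ] (ℕ → (Fin d → ℤ) → 𝔸)),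
      (∀ x, ∀ y ∈ Ω₀, (Δ (g x) + qs (Aw (q (g x)))) y = x y) ∧
      (∀ f, ∀ x ∈ Ω₀, Δ f x = covLap η (1 : (Fin d → ℤ) → Fin d → 𝔸ˣ) (Ω₀.indicator f) x) ∧
      (∀ μ, ∀ x ∈ Ω₀, qs μ x = QTZ L m Λs (1 : (Fin d → ℤ) → Fin d → 𝔸ˣ) μ x) ∧
      (∀ f j, j ≤ m → ∀ y ∈ Λs j, q f j y = QprimeIter (zdBlockingZ d L) (bgTZ L (1 : (Fin d → ℤ) → Fin d → 𝔸ˣ)) j f y) ∧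
      (∀ μ j y, Aw μ j y = a j • μ j y) ∧
      (∀ f x, x ∉ Ω₀ → g f x = 0) ∧
      (∀ f, (∀ x ∈ Ω₀, IsSelfAdjoint (f x)) → ∀ x, IsSelfAdjoint (g f x)) ∧
      (∀ f h, (∀ x, x ∉ Ω₀ → h x = 0) → (∀ y ∈ Ω₀, (Δ h + qs (Aw (q h))) y = f y) → h = g f) := by
  -- the finite carrier, the kernel and its unit matrix
  set S : Finset (Fin d → ℤ) := hΩ.toFinset with hSdef
  have hS : ∀ w, w ∈ S ↔ w ∈ Ω₀ := fun w => Set.Finite.mem_toFinset hΩ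
  set K : (Fin d → ℤ) → (Fin d → ℤ) → ℝ := fun x z =>
    ((η ^ 2)⁻¹ * ∑ μ : Fin d, ((2 : ℝ) * (if z = x then (1 : ℝ) else 0) - (if z = x + e μ then (1 : ℝ) else 0)
      - (if z = x - e μ then (1 : ℝ) else 0))) +
      (∑ j ∈ Finset.range (m + 1), (if flmZ L j x ∈ Λs j ∧ flmZ L j z = flmZ L j x then
        a j * ((((L : ℝ) ^ d)⁻¹) ^ j) ^ 2 else 0)) with hKdef
  have hK : ∀ x z, K x z = ((η ^ 2)⁻¹ * ∑ μ : Fin d, ((2 : ℝ) * (if z = x then (1 : ℝ) else 0) - (if z = x + e μ then (1 : ℝ) else 0)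
      - (if z = x - e μ then (1 : ℝ) else 0))) +
      (∑ j ∈ Finset.range (m + 1), (if flmZ L j x ∈ Λs j ∧ flmZ L j z = flmZ L j x then
        a j * ((((L : ℝ) ^ d)⁻¹) ^ j) ^ 2 else 0)) := fun x z => rfl
  set T : Matrix ↥S ↥S ℝ := Matrix.of fun x z : ↥S => K x.1 z.1 with hTdef
  have hTunit : IsUnit T := isUnit_flatMatrixZ hd hη L m Λs a ha K hK S
  have hTdet : IsUnit T.det := (Matrix.isUnit_iff_isUnit_det T).mp hTunit
  have hTT : T * T⁻¹ = 1 := Matrix.mul_nonsing_inv T hTdet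
  have hTT' : T⁻¹ * T = 1 := Matrix.nonsing_inv_mul T hTdet
  -- the letters
  let g : ((Fin d → ℤ) → 𝔸) →ₗ[ℂ] ((Fin d → ℤ) → 𝔸) :=
    { toFun := fun f w => if hw : w ∈ S then ∑ z : ↥S, (T⁻¹ ⟨w, hw⟩ z) • f z.1 else 0
      map_add' := fun f₁ f₂ => by
        funext w
        simp only [Pi.add_apply]
        split_ifs with hw
        · rw [← Finset.sum_add_distrib]
          exact Finset.sum_congr rfl fun z _ => smul_add _ _ _
        · rw [add_zero]
      map_smul' := fun c f => by
        funext w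
        simp only [Pi.smul_apply, RingHom.id_apply]
        split_ifs with hw
        · rw [Finset.smul_sum]
          exact Finset.sum_congr rfl fun z _ => (smul_comm c _ _).symm
        · rw [smul_zero] }
  let Δ : ((Fin d → ℤ) → 𝔸) →ₗ[ℂ] ((Fin d → ℤ) → 𝔸) :=
    { toFun := fun f x => covLap η (1 : (Fin d → ℤ) → Fin d → 𝔸ˣ) (Ω₀.indicator f) x
      map_add' := fun f₁ f₂ => by
        funext x
        rw [Pi.add_apply, ← covLap_flat_add]
        congr 1
        funext w
        by_cases hw : w ∈ Ω₀
        · simp only [Set.indicator_of_mem hw, Pi.add_apply]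
        · simp only [Set.indicator_of_notMem hw, Pi.add_apply, add_zero]
      map_smul' := fun c f => by
        funext x
        rw [Pi.smul_apply, RingHom.id_apply, ← covLap_flat_smul]
        congr 1
        funext w
        by_cases hw : w ∈ Ω₀
        · simp only [Set.indicator_of_mem hw, Pi.smul_apply]
        · simp only [Set.indicator_of_notMem hw, Pi.smul_apply, smul_zero] }
  let q : ((Fin d → ℤ) → 𝔸) →ₗ[ℂ] (ℕ → (Fin d → ℤ) → 𝔸) :=
    { toFun := fun f j y => if j ≤ m then
        (Λs j).indicator (QprimeIter (zdBlockingZ d L) (bgTZ L (1 : (Fin d → ℤ) → Fin d → 𝔸ˣ)) j f) y else 0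
      map_add' := fun f₁ f₂ => by
        funext j y
        simp only [Pi.add_apply]
        split_ifs with hj
        · have hadd : QprimeIter (zdBlockingZ d L) (bgTZ L (1 : (Fin d → ℤ) → Fin d → 𝔸ˣ)) j (f₁ + f₂) =
              fun y => QprimeIter (zdBlockingZ d L) (bgTZ L (1 : (Fin d → ℤ) → Fin d → 𝔸ˣ)) j f₁ y +
                QprimeIter (zdBlockingZ d L) (bgTZ L (1 : (Fin d → ℤ) → Fin d → 𝔸ˣ)) j f₂ y :=
            QprimeIter_add (zdBlockingZ d L) (bgTZ L 1) f₁ f₂ j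
          by_cases hy : y ∈ Λs j
          · simp only [Set.indicator_of_mem hy, hadd]
          · simp only [Set.indicator_of_notMem hy, add_zero]
        · rw [add_zero]
      map_smul' := fun c f => by
        funext j y
        simp only [Pi.smul_apply, RingHom.id_apply]
        split_ifs with hj
        · have hsm : QprimeIter (zdBlockingZ d L) (bgTZ L (1 : (Fin d → ℤ) → Fin d → 𝔸ˣ)) j (c • f) =
              fun y => c • QprimeIter (zdBlockingZ d L) (bgTZ L (1 : (Fin d → ℤ) → Fin d → 𝔸ˣ)) j f y :=
            QprimeIter_smul (zdBlockingZ d L) (bgTZ L 1) c f j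
          by_cases hy : y ∈ Λs j
          · simp only [Set.indicator_of_mem hy, hsm]
          · simp only [Set.indicator_of_notMem hy, smul_zero]
        · rw [smul_zero] }
  let qs : (ℕ → (Fin d → ℤ) → 𝔸) →ₗ[ℂ] ((Fin d → ℤ) → 𝔸) :=
    { toFun := fun μ x => QTZ L m Λs (1 : (Fin d → ℤ) → Fin d → 𝔸ˣ) μ x
      map_add' := fun μ ν => by funext x; exact QTZ_flat_add hLo m Λs μ ν x
      map_smul' := fun c μ => by funext x; exact QTZ_flat_smul hLo m Λs c μ x }
  let Aw : (ℕ → (Fin d → ℤ) → 𝔸) →ₗ[ℂ] (ℕ → (Fin d → ℤ) → 𝔸) :=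
    { toFun := fun μ j y => a j • μ j y
      map_add' := fun μ ν => by funext j y; simp only [Pi.add_apply, smul_add]
      map_smul' := fun c μ => by funext j y; simp only [Pi.smul_apply, RingHom.id_apply]; rw [smul_comm] }
  -- bookkeeping facts about `g`
  have hg_apply : ∀ (f : (Fin d → ℤ) → 𝔸) (w : Fin d → ℤ),
      g f w = if hw : w ∈ S then ∑ z : ↥S, (T⁻¹ ⟨w, hw⟩ z) • f z.1 else 0 := fun f w => rfl
  have hg_supp : ∀ (f : (Fin d → ℤ) → 𝔸) (w : Fin d → ℤ), w ∉ S → g f w = 0 := fun f w hw => by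
    rw [hg_apply, dif_neg hw]
  have hg_mem : ∀ (f : (Fin d → ℤ) → 𝔸) (z : ↥S), g f z.1 = ∑ w : ↥S, (T⁻¹ z w) • f w.1 := fun f z => by
    rw [hg_apply, dif_pos z.2]
  -- the flat operator of the letters is the kernel sum
  have hop : ∀ (h : (Fin d → ℤ) → 𝔸), (∀ w, w ∉ S → h w = 0) → ∀ y, (Δ h + qs (Aw (q h))) y = ∑ z ∈ S, K y z • h z := by
    intro h hsupp y
    have hind : Ω₀.indicator h = h := by
      funext w
      by_cases hw : w ∈ Ω₀
      · exact Set.indicator_of_mem hw h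
      · rw [Set.indicator_of_notMem hw, hsupp w (fun hw' => hw ((hS w).mp hw'))]
    show covLap η (1 : (Fin d → ℤ) → Fin d → 𝔸ˣ) (Ω₀.indicator h) y + QTZ L m Λs (1 : (Fin d → ℤ) → Fin d → 𝔸ˣ)
        (fun j w => a j • (if j ≤ m then
          (Λs j).indicator (QprimeIter (zdBlockingZ d L) (bgTZ L (1 : (Fin d → ℤ) → Fin d → 𝔸ˣ)) j h) w else 0)) y =
      ∑ z ∈ S, K y z • h z
    rw [hind]
    simp only [QprimeIter_bgTZ_one]
    exact flatDirichletOpZ_eq_sum_of_supp L η hLo m Λs a S h hsupp y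
  refine ⟨g, Δ, q, qs, Aw, ?_, fun f x _ => rfl, fun μ x _ => rfl, ?_, fun μ j y => rfl, ?_, ?_, ?_⟩
  · -- the right-inverse law pointwise on `Ω₀`
    intro f y hy
    have hyS : y ∈ S := (hS y).mpr hy
    rw [hop (g f) (hg_supp f) y, ← Finset.sum_coe_sort S]
    have h1 : ∀ z : ↥S, K y z.1 • g f z.1 = ∑ w : ↥S, (T ⟨y, hyS⟩ z * T⁻¹ z w) • f w.1 := by
      intro z
      rw [hg_mem f z, Finset.smul_sum]
      exact Finset.sum_congr rfl fun w _ => by rw [smul_smul, hTdef, Matrix.of_apply]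
    rw [Finset.sum_congr rfl fun z _ => h1 z, Finset.sum_comm]
    have h2 : ∀ w : ↥S, ∑ z : ↥S, (T ⟨y, hyS⟩ z * T⁻¹ z w) • f w.1 = ((1 : Matrix ↥S ↥S ℝ) ⟨y, hyS⟩ w) • f w.1 := by
      intro w
      rw [← Finset.sum_smul, ← hTT, Matrix.mul_apply]
    rw [Finset.sum_congr rfl fun w _ => h2 w]
    simp only [Matrix.one_apply, ite_smul, one_smul, zero_smul]
    rw [Finset.sum_ite_eq]
    simp
  · -- the reading of `q`
    intro f j hj y hy
    show (if j ≤ m then (Λs j).indicator (QprimeIter (zdBlockingZ d L) (bgTZ L (1 : (Fin d → ℤ) → Fin d → 𝔸ˣ)) j f) y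
      else 0) = _
    rw [if_pos hj, Set.indicator_of_mem hy]
  · -- the Dirichlet range
    intro f x hx
    exact hg_supp f x (fun hxS => hx ((hS x).mp hxS))
  · -- reality
    intro f hf x
    rw [hg_apply]
    split_ifs with hx
    · exact isSelfAdjoint_sum _ fun z _ => IsSelfAdjoint.smul (IsSelfAdjoint.all _) (hf z.1 ((hS z.1).mp z.2))
    · exact IsSelfAdjoint.zero 𝔸
  · -- uniqueness
    intro f h hsupp heq
    have hsuppS : ∀ w, w ∉ S → h w = 0 := fun w hw => hsupp w (fun hw' => hw ((hS w).mpr hw'))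
    -- the residual `r = h - g f` is `S`-supported and killed by the flat operator on `Ω₀`
    set r : (Fin d → ℤ) → 𝔸 := h - g f with hrdef
    have hrsupp : ∀ w, w ∉ S → r w = 0 := fun w hw => by
      rw [hrdef, Pi.sub_apply, hsuppS w hw, hg_supp f w hw, sub_zero]
    have hr0 : ∀ y : ↥S, ∑ z : ↥S, (T y z) • r z.1 = 0 := by
      intro y
      have hyΩ : y.1 ∈ Ω₀ := (hS y.1).mp y.2
      have e1 := hop h hsuppS y.1
      have e2 := hop (g f) (hg_supp f) y.1
      rw [heq y.1 hyΩ] at e1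
      have e3 : (Δ (g f) + qs (Aw (q (g f)))) y.1 = f y.1 := by
        -- the right-inverse law just proved, re-derived for this datum
        rw [e2, ← Finset.sum_coe_sort S]
        have h1 : ∀ z : ↥S, K y.1 z.1 • g f z.1 = ∑ w : ↥S, (T y z * T⁻¹ z w) • f w.1 := by
          intro z
          rw [hg_mem f z, Finset.smul_sum]
          exact Finset.sum_congr rfl fun w _ => by rw [smul_smul, hTdef, Matrix.of_apply]
        rw [Finset.sum_congr rfl fun z _ => h1 z, Finset.sum_comm]
        have h2 : ∀ w : ↥S, ∑ z : ↥S, (T y z * T⁻¹ z w) • f w.1 = ((1 : Matrix ↥S ↥S ℝ) y w) • f w.1 := by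
          intro w
          rw [← Finset.sum_smul, ← hTT, Matrix.mul_apply]
        rw [Finset.sum_congr rfl fun w _ => h2 w]
        simp only [Matrix.one_apply, ite_smul, one_smul, zero_smul]
        rw [Finset.sum_ite_eq]
        simp
      rw [e2] at e3
      have e4 : ∑ z ∈ S, K y.1 z • r z = 0 := by
        have : ∀ z, K y.1 z • r z = K y.1 z • h z - K y.1 z • g f z := fun z => by
          rw [hrdef, Pi.sub_apply, smul_sub]
        rw [Finset.sum_congr rfl fun z _ => this z, Finset.sum_sub_distrib, ← e1, e3, sub_self]
      rw [← Finset.sum_coe_sort S] at e4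
      rw [← e4]
      exact Finset.sum_congr rfl fun z _ => by rw [hTdef, Matrix.of_apply]
    have hr : ∀ w, r w = 0 := by
      intro w
      by_cases hw : w ∈ S
      · -- apply `T⁻¹` to the vanishing kernel sums
        have h1 : r w = ∑ x : ↥S, ((1 : Matrix ↥S ↥S ℝ) ⟨w, hw⟩ x) • r x.1 := by
          simp only [Matrix.one_apply, ite_smul, one_smul, zero_smul]
          rw [Finset.sum_ite_eq]
          simp
        rw [h1, ← hTT']
        have h2 : ∀ x : ↥S, ((T⁻¹ * T) ⟨w, hw⟩ x) • r x.1 = ∑ z : ↥S, (T⁻¹ ⟨w, hw⟩ z * T z x) • r x.1 := by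
          intro x
          rw [Matrix.mul_apply, Finset.sum_smul]
        rw [Finset.sum_congr rfl fun x _ => h2 x, Finset.sum_comm]
        refine Finset.sum_eq_zero fun z _ => ?_
        have h3 : ∑ x : ↥S, (T⁻¹ ⟨w, hw⟩ z * T z x) • r x.1 = (T⁻¹ ⟨w, hw⟩ z) • ∑ x : ↥S, (T z x) • r x.1 := by
          rw [Finset.smul_sum]
          exact Finset.sum_congr rfl fun x _ => by rw [smul_smul]
        rw [h3, hr0 z, smul_zero]
      · exact hrsupp w hw
    funext w
    have := hr w
    rw [hrdef, Pi.sub_apply, sub_eq_zero] at this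
    exact this

end Green


end Literature.MathematicalPhysics.QuantumFieldTheory.Balaban1983to89.B8Eq191FlatGreenDirichletRec
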